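import Summits.RiemannHypothesis.RiemannHypothesis.Theorems.DBNDbnLowAllTAxisBarrier
import Summits.RiemannHypothesis.RiemannHypothesis.Theorems.DBNDbnThesis
import Literature.NumberTheory.LFunctions.EquivalentsProofs
import Literature.NumberTheory.LFunctions.RiemannXiProofs
import Literature.NumberTheory.LFunctions.DeBruijnHZeroProofs
import HarnessLib

/-!
# RiemannHypothesis / DBN — which crux carries RH: `DBN.DbnHighUniform` DETECTS RH,
# `DBN.DbnLowAllT` is RH-implied and subordinate (kernel bookkeeping for LADDER-RH §1, column 3)

LINE 1 — LABEL: `Summit.RiemannHypothesis.RiemannHypothesis.Theses.DBN.DbnHighUniform` (route DBN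
crux #2, stmt-RiemannHypothesis-0278, LADDER N-P (P1)) is **RH-EQUIVALENT**, certified here by decl in
both directions: `dbnHighUniform_of_riemannHypothesis` (RH ⟹ P1, hypothesis-free) and
`riemannHypothesis_of_dbnHighUniform` (P1 ⟹ RH, **CONDITIONAL** on the computational named fact
F1 = `Literature.NumberTheory.LFunctions.platt_trudgian_numerical_rh`, Platt–Trudgian 2021 Thm. 1;
WITHOUT F1, P1 still gives RH above height `3·10¹²`, `re_eq_one_half_of_dbnHighUniform`,
hypothesis-free).  `…Theses.DBN.DbnLowAllT` (crux #3, stmt-RiemannHypothesis-0281, N-P (P2)) is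
**RH-IMPLIED** (`dbnLowAllT_of_riemannHypothesis`, hypothesis-free) and **P1-IMPLIED given F1**
(`dbnLowAllT_of_dbnHighUniform`); its converse (P2 ⟹ RH, or P2 ⟹ P1) is NOT claimed and not
expected: P2 is of certified-computation class (files `DBNDbnLowAllTAxisBarrier.lean` p423818,
`DBNDbnLowAllTNearAxisSlab.lean` p424950).  bears_on: N-C/N-P (LADDER-RH §1, COLUMN 3 DBN).
WHAT THIS IS NOT: not a proof or disproof of either crux, not evidence about RH — an equivalence is
not a proof; the file only fixes, in the kernel, WHICH of the two cruxes of route DBN carries the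
Riemann hypothesis (P1, alone, given F1) and which does not (P2); nothing here bears on the truth
of RH.

## Content (namespace `Summit.RiemannHypothesis.RiemannHypothesis.Theorems.DbnTheory`)

§1 (hypothesis-free)
* `deBruijnH_zero_ne_zero_of_forall_pos` — RH-FREE local closedness at `t = 0`: if every `H_t`,
  `t > 0`, is zero-free on a disc, then `H_0` does not vanish at its centre (Hurwitz's theorem,
  `Complex.hurwitz_eqOn_zero_or_forall_ne_zero`, along `t → 0`; the pattern of
  `HasOnlyRealZeros.isClosed_setOf`).
* `im_eq_zero_deBruijnH_zero_of_dbnHighUniform` — P1 ⟹ every zero of `H_0` with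
  `|Re z| > 6·10¹²` is real (the disc `D(z, min(|Im z|, |Re z| − 6·10¹²))` avoids the axis and
  stays in `|Re| > 6·10¹²`).
* `re_eq_one_half_of_dbnHighUniform` — P1 ⟹ every zero `s` of `ζ` with `|Im s| > 3·10¹²` has
  `Re s = 1/2` (`H_0(z) = ξ((1 + iz)/2)/8`, `deBruijnH_zero_eq_holds`; `z = −i(2s − 1)`).

§2 (P1 is RH-EQUIVALENT)
* `dbnHighUniform_of_riemannHypothesis` (free); `hasOnlyRealZeros_deBruijnH_zero_of_dbnHighUniform`,
  `riemannHypothesis_of_dbnHighUniform`, `riemannHypothesis_iff_dbnHighUniform`,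
  `dbnThesis_iff_dbnHighUniform`, `summit_iff_dbnHighUniform` (CONDITIONAL(F1): below height
  `3 000 175 332 800` the zeros are real by F1, `im_eq_zero_deBruijnH_zero_of_platt_trudgian_numerical_rh`;
  above `3·10¹²` by §1).

§3 (P2 is RH-implied and P1-implied)
* `dbnLowAllT_of_riemannHypothesis` (free).
* `dbnLowAllT_of_column` — CONDITIONAL(F1): if for every `t > 0` the zeros of `H_t` in ONE unit
  column `X ≤ Re z ≤ X + 1` (`6·10¹² − 1 ≤ X ≤ 6 000 350 665 599`) are real, then P2 — the sliding
  floor `im_eq_zero_of_axisBarrier` of `DBNDbnLowAllTAxisBarrier.lean` run on `[0, t]` for each `t`,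
  its barrier supplied by the column (for `s > 0`) and by F1 (at `s = 0`); no `Λ ≤ 1/5` needed.
* `dbnLowAllT_of_dbnHighUniform` — CONDITIONAL(F1): P1 ⟹ P2 (column at `X = 6·10¹²`);
  `summit_of_dbnHighUniform` — CONDITIONAL(F1): P1 alone closes route DBN's deciding theorem.

STATUS OF RECORD (given F1): `RH ⟺ P1 ⟹ P2`, and (given F1 + F3) `P2 ⟺` one axis-inclusive
barrier certificate (`dbnLowAllT_iff_axisBarrier_of_numerics`).  `--supports
stmt-RiemannHypothesis-0278`; closes nothing.  Theorems only (no `def`, no named fact introduced).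

References (context): D. Platt, T. Trudgian, Bull. LMS 53 (2021) 792–797, Thm. 1; D. H. J.
Polymath, Res. Math. Sci. 6 (2019) 31 = arXiv:1904.12438, Prop. 3.3; J. B. Conway, *Functions of
One Complex Variable I*, VII.2.5 (Hurwitz); N. G. de Bruijn, Duke Math. J. 17 (1950), Thm. 13;
C. M. Newman, Proc. AMS 61 (1976), Thm. 3.
-/

noncomputable section

-- D-0017: `Summit.<S>.<S>.…` is the designed namespace of a single-problem summit.
set_option linter.dupNamespace false

namespace Summit.RiemannHypothesis.RiemannHypothesis.Theorems.DbnTheory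

open Literature.NumberTheory.LFunctions
open Summit.RiemannHypothesis.RiemannHypothesis.Theses
open Complex Set Metric Filter Topology

/-! ## §1  P1 gives RH above height `3·10¹²` (hypothesis-free) -/

/-- **RH-FREE — local closedness at `t = 0`.**  If for every `t > 0` the function `H_t` has no
zero in the open disc `D(z, r)` (`r > 0`), then `H_0(z) ≠ 0`: `H_t → H_0` locally uniformly as
`t → 0` (joint continuity, `continuous_deBruijnH_uncurry`), so by Hurwitz's theorem `H_0` is
either zero-free on the disc or vanishes identically there, and the latter would make the entire
function `H_0` vanish everywhere (`exists_deBruijnH_ne_zero`). [cite: Conway1978, Ch. VII Thm. 2.5] -/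
theorem deBruijnH_zero_ne_zero_of_forall_pos {z : ℂ} {r : ℝ} (hr : 0 < r)
    (h : ∀ t : ℝ, 0 < t → ∀ w ∈ ball z r, deBruijnH t w ≠ 0) : deBruijnH 0 z ≠ 0 := by
  intro hz
  have hF : ∀ᶠ t in 𝓝 (0 : ℝ), DifferentiableOn ℂ (deBruijnH t) (ball z r) :=
    Eventually.of_forall fun t ↦ (differentiable_deBruijnH_holds t).differentiableOn
  have hlim : TendstoLocallyUniformlyOn deBruijnH (deBruijnH 0) (𝓝 (0 : ℝ)) (ball z r) :=
    tendstoLocallyUniformlyOn_of_continuous_uncurry continuous_deBruijnH_uncurry 0 isOpen_ball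
  have h0 : ∃ᶠ t in 𝓝 (0 : ℝ), ∀ w ∈ ball z r, deBruijnH t w ≠ 0 := by
    have hmem : (0 : ℝ) ∈ closure (Ioi (0 : ℝ)) := by
      rw [closure_Ioi]
      exact self_mem_Ici
    exact (mem_closure_iff_frequently.1 hmem).mono fun t ht ↦ h t ht
  rcases Complex.hurwitz_eqOn_zero_or_forall_ne_zero isOpen_ball (convex_ball z r).isPreconnected
      hF hlim h0 with h1 | h1
  · obtain ⟨w, hw⟩ := exists_deBruijnH_ne_zero 0
    have han : AnalyticOnNhd ℂ (deBruijnH 0) univ :=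
      (differentiable_deBruijnH_holds 0).differentiableOn.analyticOnNhd isOpen_univ
    have hev : deBruijnH 0 =ᶠ[𝓝 z] 0 := h1.eventuallyEq_of_mem (ball_mem_nhds z hr)
    have := han.eqOn_zero_of_preconnected_of_eventuallyEq_zero isPreconnected_univ (mem_univ z) hev
    exact hw (this (mem_univ w))
  · exact h1 z (mem_ball_self hr) hz

/-- **P1 ⟹ the zeros of `H_0` above `|Re z| = 6·10¹²` are real** (hypothesis-free).  If every zero
of every `H_t`, `t > 0`, with `|Re z| ≥ 6·10¹²` is real (`DBN.DbnHighUniform`), then every zero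
`z` of `H_0` with `|Re z| > 6·10¹²` is real: otherwise the disc about `z` of radius
`min(|Im z|, |Re z| − 6·10¹²)` avoids the real axis and lies in `|Re| > 6·10¹²`, so every `H_t`,
`t > 0`, is zero-free on it, contradicting `deBruijnH_zero_ne_zero_of_forall_pos`.
[cite: Conway1978, Ch. VII Thm. 2.5] -/
theorem im_eq_zero_deBruijnH_zero_of_dbnHighUniform (h : DBN.DbnHighUniform) {z : ℂ}
    (hz : deBruijnH 0 z = 0) (hre : 6000000000000 < |z.re|) : z.im = 0 := by
  by_contra him
  set r : ℝ := min |z.im| (|z.re| - 6000000000000) with hrdef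
  have hr : 0 < r := lt_min (abs_pos.2 him) (by linarith)
  refine deBruijnH_zero_ne_zero_of_forall_pos hr (fun t ht w hw hw0 ↦ ?_) hz
  have hdist : ‖w - z‖ < r := by rwa [mem_ball, dist_eq_norm] at hw
  have himw : w.im ≠ 0 := by
    intro h0
    have h1 : |(w - z).im| ≤ ‖w - z‖ := abs_im_le_norm (w - z)
    rw [sub_im, h0, zero_sub, abs_neg] at h1
    have h2 : r ≤ |z.im| := min_le_left _ _
    linarith
  have hrew : 6000000000000 ≤ |w.re| := by
    have h1 : |(w - z).im| ≤ ‖w - z‖ := abs_im_le_norm (w - z)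
    have h1' : |(w - z).re| ≤ ‖w - z‖ := abs_re_le_norm (w - z)
    rw [sub_re] at h1'
    have h2 : r ≤ |z.re| - 6000000000000 := min_le_right _ _
    have h3 : |z.re| - |w.re| ≤ |w.re - z.re| := by
      rw [abs_sub_comm]
      exact abs_sub_abs_le_abs_sub z.re w.re
    linarith
  exact himw (h t ht w hw0 hrew)

/-- **P1 ⟹ RH above height `3·10¹²`** (hypothesis-free).  If `DBN.DbnHighUniform` holds then every
zero `s` of `ζ` with `|Im s| > 3·10¹²` lies on the critical line.  (Such an `s` is a nontrivial
zero, hence a zero of `ξ`, `riemannXi_eq_zero_of_nontrivial`; `z = −i(2s − 1)` is then a zero of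
`H_0 = ξ((1 + iz)/2)/8` (`deBruijnH_zero_eq_holds`) with `Re z = 2 Im s`, `Im z = 1 − 2 Re s`,
and `im_eq_zero_deBruijnH_zero_of_dbnHighUniform` applies.) [cite: Titchmarsh1986, §10.1] -/
theorem re_eq_one_half_of_dbnHighUniform (h : DBN.DbnHighUniform) {s : ℂ}
    (hs : riemannZeta s = 0) (him : 3000000000000 < |s.im|) : s.re = 1 / 2 := by
  have him0 : s.im ≠ 0 := by
    intro h0
    rw [h0, abs_zero] at him
    linarith
  have htriv : ¬∃ n : ℕ, s = -2 * (n + 1) := by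
    rintro ⟨n, hn⟩
    apply him0
    rw [hn]
    simp
  have hone : s ≠ 1 := by
    rintro rfl
    simp at him0
  have hxi : riemannXi s = 0 := riemannXi_eq_zero_of_nontrivial hs htriv hone
  set z : ℂ := -I * (2 * s - 1) with hzdef
  have hsz : (1 / 2 + I * z / 2 : ℂ) = s := by
    rw [hzdef]
    linear_combination (-(2 * s - 1) / 2) * I_sq
  have hz : deBruijnH 0 z = 0 := by
    rw [deBruijnH_zero_eq_holds, hsz, hxi, zero_div]
  have hzre : z.re = 2 * s.im := by
    rw [hzdef]
    simp [mul_re, sub_re, sub_im]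
  have hzim : z.im = 1 - 2 * s.re := by
    rw [hzdef]
    simp [mul_im, sub_re, sub_im]
  have hre : 6000000000000 < |z.re| := by
    rw [hzre, abs_mul, abs_two]
    linarith
  have := im_eq_zero_deBruijnH_zero_of_dbnHighUniform h hz hre
  rw [hzim] at this
  linarith

/-! ## §2  P1 is RH-EQUIVALENT (⟸ hypothesis-free, ⟹ CONDITIONAL on F1) -/

/-- **RH ⟹ P1** (hypothesis-free): RH gives thesis X of route DBN
(`dbnThesis_iff_riemannHypothesis`), of which `DBN.DbnHighUniform` is a special case
(`dbnHighUniform_of_dbnThesis`). [folklore] -/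
theorem dbnHighUniform_of_riemannHypothesis (hRH : _root_.RiemannHypothesis) : DBN.DbnHighUniform :=
  dbnHighUniform_of_dbnThesis (dbnThesis_iff_riemannHypothesis.2 hRH)

/-- **CONDITIONAL(F1) — P1 ⟹ `H_0` has only real zeros.**  Zeros of `H_0` with
`|Re z| ≤ 6 000 350 665 600` are real by F1 (Platt–Trudgian's RH verification to height
`3 000 175 332 800`, `im_eq_zero_deBruijnH_zero_of_platt_trudgian_numerical_rh`); zeros with
`|Re z| > 6·10¹²` are real by P1 (`im_eq_zero_deBruijnH_zero_of_dbnHighUniform`).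
[cite: PlattTrudgianBLMS2021, Thm. 1] -/
theorem hasOnlyRealZeros_deBruijnH_zero_of_dbnHighUniform (h₁ : platt_trudgian_numerical_rh)
    (h : DBN.DbnHighUniform) : HasOnlyRealZeros (deBruijnH 0) := by
  intro z hz
  rcases le_or_gt |z.re| 6000350665600 with hle | hgt
  · exact im_eq_zero_deBruijnH_zero_of_platt_trudgian_numerical_rh h₁ hz hle
  · exact im_eq_zero_deBruijnH_zero_of_dbnHighUniform h hz (by linarith)

/-- **CONDITIONAL(F1) — P1 ⟹ RH.**  `H_0` has only real zeros
(`hasOnlyRealZeros_deBruijnH_zero_of_dbnHighUniform`), which is RH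
(`dbnThesis_iff_hasOnlyRealZeros_deBruijnH_zero`, `dbnThesis_iff_riemannHypothesis`).
[cite: PlattTrudgianBLMS2021, Thm. 1] -/
theorem riemannHypothesis_of_dbnHighUniform (h₁ : platt_trudgian_numerical_rh)
    (h : DBN.DbnHighUniform) : _root_.RiemannHypothesis :=
  dbnThesis_iff_riemannHypothesis.1
    (dbnThesis_iff_hasOnlyRealZeros_deBruijnH_zero.2
      (hasOnlyRealZeros_deBruijnH_zero_of_dbnHighUniform h₁ h))

/-- **CONDITIONAL(F1) — `RH ↔ P1`**: the crux `DBN.DbnHighUniform` is RH-EQUIVALENT given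
Platt–Trudgian's numerical verification F1.  An equivalence is not a proof.
[cite: PlattTrudgianBLMS2021, Thm. 1] -/
theorem riemannHypothesis_iff_dbnHighUniform (h₁ : platt_trudgian_numerical_rh) :
    _root_.RiemannHypothesis ↔ DBN.DbnHighUniform :=
  ⟨dbnHighUniform_of_riemannHypothesis, riemannHypothesis_of_dbnHighUniform h₁⟩

/-- **CONDITIONAL(F1) — thesis X of route DBN ↔ P1**: given F1 the route's target
`DBN.DbnThesis` (`∀ t > 0`, `H_t` real-rooted) collapses to the single crux `DBN.DbnHighUniform`.
[cite: PlattTrudgianBLMS2021, Thm. 1] -/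
theorem dbnThesis_iff_dbnHighUniform (h₁ : platt_trudgian_numerical_rh) :
    DBN.DbnThesis ↔ DBN.DbnHighUniform :=
  ⟨dbnHighUniform_of_dbnThesis,
    fun h ↦ dbnThesis_iff_riemannHypothesis.2 (riemannHypothesis_of_dbnHighUniform h₁ h)⟩

/-- **CONDITIONAL(F1) — the summit ↔ P1** (`Summit.RiemannHypothesis` is Mathlib's
`RiemannHypothesis`, `dbnThesis_iff_summit`). [cite: PlattTrudgianBLMS2021, Thm. 1] -/
theorem summit_iff_dbnHighUniform (h₁ : platt_trudgian_numerical_rh) :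
    Summit.RiemannHypothesis ↔ DBN.DbnHighUniform :=
  dbnThesis_iff_summit.symm.trans (dbnThesis_iff_dbnHighUniform h₁)

/-! ## §3  P2 is RH-implied, and P1-implied given F1 -/

/-- **RH ⟹ P2** (hypothesis-free): `DBN.DbnLowAllT` is a special case of thesis X
(`dbnLowAllT_of_dbnThesis`, `dbnThesis_iff_riemannHypothesis`).  The converse is NOT claimed.
[folklore] -/
theorem dbnLowAllT_of_riemannHypothesis (hRH : _root_.RiemannHypothesis) : DBN.DbnLowAllT :=
  dbnLowAllT_of_dbnThesis (dbnThesis_iff_riemannHypothesis.2 hRH)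

/-- **CONDITIONAL(F1) — P2 from ONE unit column of real zeros.**  Assume F1 and let
`6·10¹² − 1 ≤ X ≤ 6 000 350 665 599`.  If for every `t > 0` every zero of `H_t` with
`X ≤ Re z ≤ X + 1` is real, then every zero of every `H_t`, `t > 0`, with `|Re z| < 6·10¹²` is
real (`DBN.DbnLowAllT`).  Proof: for each `t`, the sliding-floor principle
`im_eq_zero_of_axisBarrier` on `[0, t]` — numerical RH in the box `|Re z| ≤ X` at time `0` (F1)
and the axis barrier in the column, supplied by the hypothesis for `0 < s ≤ t` and by F1 at
`s = 0` (`axisBarrier_of_im_eq_zero`).  No bound `Λ ≤ 1/5` is used.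
[cite: Polymath2019, Prop. 3.3] [cite: PlattTrudgianBLMS2021, Thm. 1] -/
theorem dbnLowAllT_of_column (h₁ : platt_trudgian_numerical_rh) {X : ℝ}
    (hX : 6000000000000 - 1 ≤ X) (hX' : X ≤ 6000350665599)
    (hcol : ∀ t : ℝ, 0 < t → ∀ z : ℂ, deBruijnH t z = 0 → X ≤ z.re → z.re ≤ X + 1 → z.im = 0) :
    DBN.DbnLowAllT := by
  intro t ht z hz hre
  have h0 : ∀ u : ℂ, deBruijnH 0 u = 0 → |u.re| ≤ X → u.im = 0 := fun u hu hure ↦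
    im_eq_zero_deBruijnH_zero_of_platt_trudgian_numerical_rh h₁ hu (hure.trans (by linarith))
  have hcol' : ∀ s : ℝ, 0 ≤ s → s ≤ t → ∀ u : ℂ, deBruijnH s u = 0 → X ≤ u.re → u.re ≤ X + 1 →
      u.im = 0 := by
    intro s hs _ u hu hXu huX
    rcases hs.eq_or_lt with h0s | hspos
    · rw [← h0s] at hu
      refine im_eq_zero_deBruijnH_zero_of_platt_trudgian_numerical_rh h₁ hu ?_
      rw [abs_le]
      constructor <;> linarith
    · exact hcol s hspos u hu hXu huX
  exact im_eq_zero_of_axisBarrier h0 (axisBarrier_of_im_eq_zero hcol') ht.le le_rfl hz (by linarith)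

/-- **CONDITIONAL(F1) — P1 ⟹ P2**: the reality of the zeros of `H_t`, `t > 0`, with
`|Re z| ≥ 6·10¹²` (`DBN.DbnHighUniform`) supplies the unit column at `X = 6·10¹²` of
`dbnLowAllT_of_column`.  Hence, given F1, crux #3 `DBN.DbnLowAllT` is subordinate to crux #2.
[cite: Polymath2019, Prop. 3.3] [cite: PlattTrudgianBLMS2021, Thm. 1] -/
theorem dbnLowAllT_of_dbnHighUniform (h₁ : platt_trudgian_numerical_rh) (h : DBN.DbnHighUniform) :
    DBN.DbnLowAllT :=
  dbnLowAllT_of_column h₁ (X := 6000000000000) (by norm_num) (by norm_num)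
    fun t ht z hz hXz _ ↦ h t ht z hz (hXz.trans (le_abs_self z.re))

/-- **CONDITIONAL(F1) — P1 alone feeds route DBN's deciding theorem**: with F1,
`DBN.closes` needs only `DBN.DbnHighUniform` (`DBN.DbnLowAllT` by `dbnLowAllT_of_dbnHighUniform`,
`DBN.Assembly` by the PROVED Literature theorem
`riemannHypothesis_of_hasOnlyRealZeros_deBruijnH_holds` via `dbnThesis_iff_summit`).  Recorded
so that the LADDER's N-P column reads: RH-hard content = P1; P2 = certified-computation class.
[cite: PlattTrudgianBLMS2021, Thm. 1] -/
theorem summit_of_dbnHighUniform (h₁ : platt_trudgian_numerical_rh) (h : DBN.DbnHighUniform) :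
    Summit.RiemannHypothesis :=
  DBN.closes h (dbnLowAllT_of_dbnHighUniform h₁ h) fun hX ↦ dbnThesis_iff_summit.1 hX

end Summit.RiemannHypothesis.RiemannHypothesis.Theorems.DbnTheory

end
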